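import Literature.Probability.RandomPlanarGeometry.SLEPointFlowIto
import Literature.Probability.RandomPlanarGeometry.SLEDerivRatioSupersolution
import Literature.Analysis.FunctionSpaces.ItoProductRule
import Literature.Probability.Process.BoundedItoIntegral
import HarnessLib

/-!
# Itô calculus for Rohde–Schramm's observable with the elementary supersolution (`κ < 8`)

Topic `Probability/RandomPlanarGeometry`; step S4a of the discharge of Rohde–Schramm's Lemma 6.3
(`κ < 8`; named fact `Literature.Probability.RandomPlanarGeometry.exists_tendsto_sleDerivRatio_of_lt_eight`).
For `z ∈ ℍ`, the localizing time `ρₙ` and the stopped/truncated processes of `SLEPointFlowStop`,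
`SLEPointFlowIto`, we run the Itô calculus of the printed proof (Rohde–Schramm (2005), p. 904: "A
direct application of Itô's formula shows that `Mₜ := (ŷ|gₜ'(ẑ)|/yₜ)^a Ĝ(zₜ)` is a local
martingale") with the hypergeometric `Ĝ` replaced by the elementary supersolution
`G = rsSuperG κ` (`SLEDerivRatioSupersolution`), entirely inside the tree's Itô calculus
(`ito_formula_itoProcess_ae_holds`, `IsItoProcess.mul_timeIntegral`,
`Literature.Probability.Process.exists_isItoIntegral_of_abs_le`):

* `slePointInvIm = 1/Y` (finite variation, `inv_slePointImStop_eq`) and the **slope**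
  `slePointSlope = w = X · (1/Y)`: an Itô process by the product rule (`isItoProcess_slePointSlope`),
  with drift `𝟙 4X/(YQ)` and diffusion coefficient `𝟙(-√κ)/Y` — Rohde–Schramm's `wₜ = xₜ/yₜ`;
* `G(w)`: an Itô process by Itô's formula (`isItoProcess_rsSuperG_slePointSlope`), with drift
  `b_w G'(w) + ½ σ_w² G''(w)` and diffusion coefficient `σ_w G'(w)`;
* the **observable** `sleSuperObs = G(w) · ψ^a`, `a = rsSuperExp κ`, `ψ^a = slePointRatioPow`, and
  its product-rule coefficient processes `sleSuperObsDrift` (`G(w)·(a 𝟙rate ψ^a) + ψ^a·(b_w G' +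
  ½σ_w² G'')`) and `sleSuperObsDiffusion` (`σ_w G'(w) ψ^a`) are **defined** here; the
  semimartingale decomposition of the observable (product rule) and the sign of its drift
  (`rsSuperDrift_nonpos`) are the next step (S4b, `SLEDerivRatioObservable.lean`).

All Itô integrals are those of bounded progressive integrands (everything is bounded on `[0, ρₙ]`
by construction of `ρₙ`), hence genuine martingales; no localization beyond `ρₙ` is needed.

## References

* S. Rohde, O. Schramm, *Basic properties of SLE*, Ann. of Math. 161 (2005), proof of Lemma 6.3
  (pp. 904–905).
* D. Revuz, M. Yor, *Continuous Martingales and Brownian Motion* (1999), Ch. IV, Prop. (3.1),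
  Thm (3.3).
-/

noncomputable section

open Set Filter MeasureTheory Metric Complex
open _root_.Topology
open scoped NNReal ENNReal

namespace Literature.Probability.RandomPlanarGeometry

open Loewner Literature.Probability.Process Literature.Analysis.FunctionSpaces

variable (κ : ℝ≥0) (z : ℂ) (n : ℕ)

/-! ### The processes -/

/-- `1/Y`: the reciprocal of the stopped imaginary part (finite variation). [folklore] -/
def slePointInvIm (t : ℝ≥0) (ω : ℝ≥0 → ℝ) : ℝ :=
  (slePointImStop κ z n t ω)⁻¹

/-- Rohde–Schramm's slope **`w = x/y`** stopped at `ρₙ`, as the product `X · (1/Y)`.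
[cite: RohdeSchramm2005, Lemma 6.3 (proof)] -/
def slePointSlope (t : ℝ≥0) (ω : ℝ≥0 → ℝ) : ℝ :=
  slePointReStop κ z n t ω * slePointInvIm κ z n t ω

/-- The drift `X · (𝟙 2/(YQ)) + (1/Y) · (𝟙 2X/Q) = 𝟙 4X/(YQ)` of the slope (product rule).
[folklore] -/
def slePointSlopeDrift (t : ℝ≥0) (ω : ℝ≥0 → ℝ) : ℝ :=
  slePointReStop κ z n t ω * slePointInvImRate κ z n t ω +
    slePointInvIm κ z n t ω * slePointReDrift κ z n t ω

/-- The diffusion coefficient `𝟙(-√κ) / Y` of the slope (product rule). [folklore] -/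
def slePointSlopeDiffusion (t : ℝ≥0) (ω : ℝ≥0 → ℝ) : ℝ :=
  slePointDiffusion κ z n t ω * slePointInvIm κ z n t ω

/-- The Itô drift `b_w G'(w) + ½ σ_w² G''(w)` of `G(w)`, `G = rsSuperG κ`. [folklore] -/
def rsSuperGDrift (t : ℝ≥0) (ω : ℝ≥0 → ℝ) : ℝ :=
  slePointSlopeDrift κ z n t ω * deriv (rsSuperG κ) (slePointSlope κ z n t ω) +
    2⁻¹ * slePointSlopeDiffusion κ z n t ω ^ 2 * iteratedDeriv 2 (rsSuperG κ) (slePointSlope κ z n t ω)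

/-- The diffusion coefficient `σ_w G'(w)` of `G(w)`. [folklore] -/
def rsSuperGDiffusion (t : ℝ≥0) (ω : ℝ≥0 → ℝ) : ℝ :=
  slePointSlopeDiffusion κ z n t ω * deriv (rsSuperG κ) (slePointSlope κ z n t ω)

/-- The rate `a · 𝟙 rate · ψ^a` of the finite-variation factor `ψ^a`, `a = rsSuperExp κ`.
[folklore] -/
def slePointRatioPowRate (t : ℝ≥0) (ω : ℝ≥0 → ℝ) : ℝ :=
  rsSuperExp κ * slePointRatioRate κ z n t ω * slePointRatioPow κ z n (rsSuperExp κ) t ω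

/-- **The observable `M = G(w) · ψ^a`** (Rohde–Schramm's `Mₜ = (ŷ|gₜ'(ẑ)|/yₜ)^a Ĝ(zₜ)` with the
elementary supersolution `G = rsSuperG κ` in place of `Ĝ`, stopped at `ρₙ`).
[cite: RohdeSchramm2005, Lemma 6.3 (proof)] -/
def sleSuperObs (t : ℝ≥0) (ω : ℝ≥0 → ℝ) : ℝ :=
  rsSuperG κ (slePointSlope κ z n t ω) * slePointRatioPow κ z n (rsSuperExp κ) t ω

/-- The drift `G(w) · (a 𝟙rate ψ^a) + ψ^a · (b_w G' + ½σ_w² G'')` of the observable (product rule).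
[folklore] -/
def sleSuperObsDrift (t : ℝ≥0) (ω : ℝ≥0 → ℝ) : ℝ :=
  rsSuperG κ (slePointSlope κ z n t ω) * slePointRatioPowRate κ z n t ω +
    slePointRatioPow κ z n (rsSuperExp κ) t ω * rsSuperGDrift κ z n t ω

/-- The diffusion coefficient `σ_w G'(w) ψ^a` of the observable. [folklore] -/
def sleSuperObsDiffusion (t : ℝ≥0) (ω : ℝ≥0 → ℝ) : ℝ :=
  rsSuperGDiffusion κ z n t ω * slePointRatioPow κ z n (rsSuperExp κ) t ω

variable {κ z n}

/-! ### `1/Y` and the bound on `X` -/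

/-- `1/Y > 0`. [folklore] -/
theorem slePointInvIm_pos (hz : 0 < z.im) (t : ℝ≥0) (ω : ℝ≥0 → ℝ) : 0 < slePointInvIm κ z n t ω :=
  inv_pos.2 (slePointImStop_pos hz t ω)

/-- `|1/Y| ≤ (n+2)/im z`. [folklore] -/
theorem abs_slePointInvIm_le (hz : 0 < z.im) (t : ℝ≥0) (ω : ℝ≥0 → ℝ) :
    |slePointInvIm κ z n t ω| ≤ (n + 2) / z.im := by
  rw [abs_of_pos (slePointInvIm_pos hz t ω)]
  exact inv_slePointImStop_le hz t ω

/-- `1/Y` at time `0` is `1/im z`. [folklore] -/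
theorem slePointInvIm_zero (hz : 0 < z.im) (ω : ℝ≥0 → ℝ) : slePointInvIm κ z n 0 ω = (z.im)⁻¹ := by
  rw [slePointInvIm, slePointImStop_zero hz]

/-- `1/Y_t = 1/Y_0 + ∫₀ᵗ 𝟙 2/(YQ) ds` (every `ω`, `t`). [folklore] -/
theorem slePointInvIm_eq (hz : 0 < z.im) (ω : ℝ≥0 → ℝ) (t : ℝ≥0) :
    slePointInvIm κ z n t ω = slePointInvIm κ z n 0 ω +
      ∫ s in (0 : ℝ)..t, slePointInvImRate κ z n s.toNNReal ω := by
  rw [slePointInvIm_zero hz, slePointInvIm, inv_slePointImStop_eq hz t ω]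
  rfl

/-- `1/Y` has continuous paths. [folklore] -/
theorem continuous_slePointInvIm (hz : 0 < z.im) (ω : ℝ≥0 → ℝ) :
    Continuous fun t ↦ slePointInvIm κ z n t ω :=
  (continuous_slePointImStop hz ω).inv₀ fun t ↦ (slePointImStop_pos hz t ω).ne'

/-- `1/Y` is strongly adapted. [folklore] -/
theorem stronglyAdapted_slePointInvIm (κ : ℝ≥0) (hz : 0 < z.im) (n : ℕ) :
    StronglyAdapted brownianFiltration (slePointInvIm κ z n) := fun t ↦
  ((stronglyAdapted_slePointImStop κ hz n t).measurable.inv).stronglyMeasurable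

/-- `1/Y` is progressive. [folklore] -/
theorem isStronglyProgressive_slePointInvIm (κ : ℝ≥0) (hz : 0 < z.im) (n : ℕ) :
    IsStronglyProgressive brownianFiltration (slePointInvIm κ z n) :=
  (stronglyAdapted_slePointInvIm κ hz n).isStronglyProgressive_of_continuous
    (continuous_slePointInvIm hz)

/-- **`X` is bounded**: `|X_t| ≤ |re z| + (n+1)(n+2)/im z + (n+1)` (integrated Loewner equation:
drift bounded by `(n+2)/im z` on a clock `≤ n+1`, and `|W| ≤ n+1` before `ρₙ`). [folklore] -/
theorem abs_slePointReStop_le (hz : 0 < z.im) (t : ℝ≥0) (ω : ℝ≥0 → ℝ) :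
    |slePointReStop κ z n t ω| ≤ |z.re| + (n + 1) * ((n + 2) / z.im) + (n + 1) := by
  set u : ℝ≥0 := (min (t : WithTop ℝ≥0) (slePointLocTime κ z n ω)).untopA with hu
  have huρ : (u : WithTop ℝ≥0) ≤ slePointLocTime κ z n ω := slePointClock_le_locTime t ω
  have hule : (u : ℝ) ≤ n + 1 := by
    have h := huρ.trans (slePointLocTime_le n ω)
    exact_mod_cast (WithTop.coe_le_coe.1 h)
  have hW : |sleDriving κ ω u| ≤ n + 1 := abs_sleDriving_le_of_le_locTime huρ
  -- the drift integral
  have hint : timeIntegral (slePointReDrift κ z n) t ω =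
      ∫ s in (0 : ℝ)..u, slePointReDrift κ z n s.toNNReal ω := by
    rw [slePointReDrift, timeIntegral_trunc, ← hu, ← slePointReDrift]
    simp only [timeIntegral]
    refine intervalIntegral.integral_congr fun s hs ↦ ?_
    rw [uIcc_of_le u.coe_nonneg] at hs
    rw [slePointReDrift, trunc_of_le (toNNReal_le_locTime_of_mem huρ hs)]
  have hI : |timeIntegral (slePointReDrift κ z n) t ω| ≤ (n + 1) * ((n + 2) / z.im) := by
    rw [hint]
    have h := intervalIntegral.norm_integral_le_of_norm_le_const (a := (0 : ℝ)) (b := u)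
      (C := (n + 2) / z.im) (f := fun s ↦ slePointReDrift κ z n s.toNNReal ω)
      fun s _ ↦ by rw [Real.norm_eq_abs]; exact abs_slePointReDrift_le hz _ _
    rw [Real.norm_eq_abs, sub_zero, abs_of_nonneg u.coe_nonneg] at h
    have hC : 0 ≤ (n + 2 : ℝ) / z.im := div_nonneg (by positivity) hz.le
    calc _ ≤ (n + 2) / z.im * u := h
      _ ≤ (n + 2) / z.im * (n + 1) := mul_le_mul_of_nonneg_left hule hC
      _ = (n + 1) * ((n + 2) / z.im) := by ring
  rw [slePointReStop_eq hz t ω, ← hu]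
  calc |z.re + timeIntegral (slePointReDrift κ z n) t ω - sleDriving κ ω u|
      ≤ |z.re + timeIntegral (slePointReDrift κ z n) t ω| + |sleDriving κ ω u| := abs_sub _ _
    _ ≤ |z.re| + |timeIntegral (slePointReDrift κ z n) t ω| + |sleDriving κ ω u| := by
        gcongr; exact abs_add_le _ _
    _ ≤ |z.re| + (n + 1) * ((n + 2) / z.im) + (n + 1) := by gcongr

/-! ### The slope `w = X/Y` is an Itô process -/

/-- The slope at time `0` is `re z / im z`. [folklore] -/
theorem slePointSlope_zero (hz : 0 < z.im) (ω : ℝ≥0 → ℝ) : slePointSlope κ z n 0 ω = z.re / z.im := by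
  rw [slePointSlope, slePointReStop_zero hz, slePointInvIm_zero hz, div_eq_mul_inv]

/-- The slope is bounded: `|w| ≤ Cx (n+2)/im z`. [folklore] -/
theorem abs_slePointSlope_le (hz : 0 < z.im) (t : ℝ≥0) (ω : ℝ≥0 → ℝ) :
    |slePointSlope κ z n t ω| ≤ (|z.re| + (n + 1) * ((n + 2) / z.im) + (n + 1)) * ((n + 2) / z.im) := by
  rw [slePointSlope, abs_mul]
  exact mul_le_mul (abs_slePointReStop_le hz t ω) (abs_slePointInvIm_le hz t ω) (abs_nonneg _)
    (by positivity)

/-- The slope has continuous paths. [folklore] -/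
theorem continuous_slePointSlope (hz : 0 < z.im) (ω : ℝ≥0 → ℝ) :
    Continuous fun t ↦ slePointSlope κ z n t ω :=
  (continuous_slePointReStop hz ω).mul (continuous_slePointInvIm hz ω)

/-- The slope is strongly adapted. [folklore] -/
theorem stronglyAdapted_slePointSlope (κ : ℝ≥0) (hz : 0 < z.im) (n : ℕ) :
    StronglyAdapted brownianFiltration (slePointSlope κ z n) := fun t ↦
  (stronglyAdapted_slePointReStop κ hz n t).mul (stronglyAdapted_slePointInvIm κ hz n t)

/-- The slope is progressive. [folklore] -/
theorem isStronglyProgressive_slePointSlope (κ : ℝ≥0) (hz : 0 < z.im) (n : ℕ) :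
    IsStronglyProgressive brownianFiltration (slePointSlope κ z n) :=
  (stronglyAdapted_slePointSlope κ hz n).isStronglyProgressive_of_continuous
    (continuous_slePointSlope hz)

/-- The diffusion coefficient of the slope is progressive and bounded by `√κ (n+2)/im z`.
[folklore] -/
theorem isStronglyProgressive_slePointSlopeDiffusion (κ : ℝ≥0) (hz : 0 < z.im) (n : ℕ) :
    IsStronglyProgressive brownianFiltration (slePointSlopeDiffusion κ z n) :=
  (isStronglyProgressive_slePointDiffusion κ hz n).mul (isStronglyProgressive_slePointInvIm κ hz n)

/-- See `isStronglyProgressive_slePointSlopeDiffusion`. [folklore] -/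
theorem abs_slePointSlopeDiffusion_le (hz : 0 < z.im) (t : ℝ≥0) (ω : ℝ≥0 → ℝ) :
    |slePointSlopeDiffusion κ z n t ω| ≤ Real.sqrt κ * ((n + 2) / z.im) := by
  rw [slePointSlopeDiffusion, abs_mul]
  exact mul_le_mul (abs_slePointDiffusion_le t ω) (abs_slePointInvIm_le hz t ω) (abs_nonneg _)
    (Real.sqrt_nonneg _)

/-- **The slope is an Itô process** (product rule `d(X·(1/Y)) = X d(1/Y) + (1/Y) dX`): drift
`X · 𝟙2/(YQ) + (1/Y) · 𝟙2X/Q`, diffusion coefficient `𝟙(-√κ)/Y`. Rohde–Schramm's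
`wₜ = xₜ/yₜ` ("a time-homogeneous diffusion as a function of `u = log yₜ`", p. 904), here in the
original time and localized. [cite: RohdeSchramm2005, Lemma 6.3 (proof)] -/
theorem isItoProcess_slePointSlope (hz : 0 < z.im) :
    IsItoProcess (slePointSlope κ z n) (slePointSlopeDrift κ z n) (slePointSlopeDiffusion κ z n)
      brownian brownianFiltration preWienerMeasure := by
  have hσ := isStronglyProgressive_slePointDiffusion κ hz n
  have hXp := isStronglyProgressive_slePointReStop κ hz n
  have hAp := isStronglyProgressive_slePointInvIm κ hz n
  obtain ⟨KX, hKX, hKXM, -⟩ := exists_isItoIntegral_of_abs_le (hσ.mul hXp)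
    (C := Real.sqrt κ * (|z.re| + (n + 1) * ((n + 2) / z.im) + (n + 1))) fun t ω ↦ by
      rw [abs_mul]
      exact mul_le_mul (abs_slePointDiffusion_le t ω) (abs_slePointReStop_le hz t ω) (abs_nonneg _)
        (Real.sqrt_nonneg _)
  obtain ⟨K, hK, hKM, -⟩ := exists_isItoIntegral_of_abs_le (hσ.mul hAp)
    (C := Real.sqrt κ * ((n + 2) / z.im)) fun t ω ↦ by
      rw [abs_mul]
      exact mul_le_mul (abs_slePointDiffusion_le t ω) (abs_slePointInvIm_le hz t ω) (abs_nonneg _)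
        (Real.sqrt_nonneg _)
  exact (isItoProcess_slePointReStop hz).mul_timeIntegral (stronglyAdapted_slePointReStop κ hz n)
    (continuous_slePointReStop hz) hσ (stronglyAdapted_slePointInvIm κ hz n)
    (continuous_slePointInvIm hz) (ae_of_all _ (slePointInvIm_eq hz))
    (ae_of_all _ fun ω t ↦ integrableOn_slePointInvImRate hz ω t) hKX hKXM hK hKM

/-! ### `G(w)` is an Itô process (Itô's formula) -/

/-- Bounds for `G'`, `G''` on the range of the slope: there is `C` with `|G'(w_t)| ≤ C` and
`|G''(w_t)| ≤ C` for all `t, ω` (continuity on the compact interval containing the bounded slope).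
[folklore] -/
theorem exists_bound_deriv_rsSuperG_slePointSlope (hz : 0 < z.im) :
    ∃ C : ℝ, 0 ≤ C ∧ ∀ t ω, |deriv (rsSuperG κ) (slePointSlope κ z n t ω)| ≤ C ∧
      |iteratedDeriv 2 (rsSuperG κ) (slePointSlope κ z n t ω)| ≤ C := by
  set R : ℝ := (|z.re| + (n + 1) * ((n + 2) / z.im) + (n + 1)) * ((n + 2) / z.im) with hR
  have hf1 : Continuous (deriv (rsSuperG (κ : ℝ))) :=
    (contDiff_rsSuperG (κ : ℝ) (n := 2)).continuous_deriv (by norm_num)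
  have hf2 : Continuous (iteratedDeriv 2 (rsSuperG (κ : ℝ))) :=
    (contDiff_rsSuperG (κ : ℝ) (n := 2)).continuous_iteratedDeriv 2 le_rfl
  obtain ⟨C1, hC1⟩ := isCompact_Icc.exists_bound_of_continuousOn (hf1.continuousOn (s := Icc (-R) R))
  obtain ⟨C2, hC2⟩ := isCompact_Icc.exists_bound_of_continuousOn (hf2.continuousOn (s := Icc (-R) R))
  have hmem : ∀ t ω, slePointSlope κ z n t ω ∈ Icc (-R) R := fun t ω ↦
    abs_le.1 (abs_slePointSlope_le hz t ω)
  refine ⟨max (max C1 C2) 0, le_max_right _ _, fun t ω ↦ ⟨?_, ?_⟩⟩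
  · have := hC1 _ (hmem t ω)
    rw [Real.norm_eq_abs] at this
    exact this.trans ((le_max_left _ _).trans (le_max_left _ _))
  · have := hC2 _ (hmem t ω)
    rw [Real.norm_eq_abs] at this
    exact this.trans ((le_max_right _ _).trans (le_max_left _ _))

/-- The diffusion coefficient `σ_w G'(w)` of `G(w)` is progressive. [folklore] -/
theorem isStronglyProgressive_rsSuperGDiffusion (κ : ℝ≥0) (hz : 0 < z.im) (n : ℕ) :
    IsStronglyProgressive brownianFiltration (rsSuperGDiffusion κ z n) :=
  (isStronglyProgressive_slePointSlopeDiffusion κ hz n).mul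
    (IsStronglyProgressive.continuous_comp (isStronglyProgressive_slePointSlope κ hz n)
      ((contDiff_rsSuperG (κ : ℝ) (n := 2)).continuous_deriv (by norm_num)))

/-- **`G(w)` is an Itô process** (Itô's formula for the `C²` function `G = rsSuperG κ` along the
slope): almost surely, for all `t`,
`G(w_t) = G(w_0) + ∫₀ᵗ (b_w G'(w) + ½σ_w² G''(w)) ds + K_t` with `K = ∫ σ_w G'(w) dB` a martingale.
[cite: RevuzYor1999, Ch. IV Thm (3.3) and Remark 1] -/
theorem isItoProcess_rsSuperG_slePointSlope (hz : 0 < z.im) :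
    ∃ K : ℝ≥0 → (ℝ≥0 → ℝ) → ℝ,
      IsItoIntegral (rsSuperGDiffusion κ z n) brownian K brownianFiltration preWienerMeasure ∧
      Martingale K brownianFiltration preWienerMeasure ∧
      IsItoProcess (fun t ω ↦ rsSuperG κ (slePointSlope κ z n t ω)) (rsSuperGDrift κ z n)
        (rsSuperGDiffusion κ z n) brownian brownianFiltration preWienerMeasure ∧
      ∀ᵐ ω ∂preWienerMeasure, ∀ t : ℝ≥0, rsSuperG κ (slePointSlope κ z n t ω) =
        rsSuperG κ (slePointSlope κ z n 0 ω) + timeIntegral (rsSuperGDrift κ z n) t ω + K t ω := by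
  obtain ⟨C, hC0, hC⟩ := exists_bound_deriv_rsSuperG_slePointSlope hz (κ := κ) (n := n)
  have hσw := isStronglyProgressive_slePointSlopeDiffusion κ hz n
  have hprog := isStronglyProgressive_rsSuperGDiffusion κ hz n
  obtain ⟨K, hK, hKM, -⟩ := exists_isItoIntegral_of_abs_le hprog
    (C := Real.sqrt κ * ((n + 2) / z.im) * C) fun t ω ↦ by
      rw [rsSuperGDiffusion, abs_mul]
      exact mul_le_mul (abs_slePointSlopeDiffusion_le hz t ω) (hC t ω).1 (abs_nonneg _)
        (mul_nonneg (Real.sqrt_nonneg _) (div_nonneg (by positivity) hz.le))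
  have hw := isItoProcess_slePointSlope hz (κ := κ) (n := n)
  have hf : ContDiff ℝ 2 (Function.uncurry fun (_ : ℝ) (v : ℝ) ↦ rsSuperG κ v) :=
    contDiff_uncurry_rsSuperG (κ : ℝ)
  have hwa : Adapted brownianFiltration (slePointSlope κ z n) := fun t ↦
    (stronglyAdapted_slePointSlope κ hz n t).measurable
  have hK' : IsItoIntegral (fun t ω ↦ slePointSlopeDiffusion κ z n t ω *
      deriv ((fun (_ : ℝ) (v : ℝ) ↦ rsSuperG κ v) t) (slePointSlope κ z n t ω)) brownian K
      brownianFiltration preWienerMeasure := hK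
  have hito := ito_formula_itoProcess_ae_holds (fun (_ : ℝ) (v : ℝ) ↦ rsSuperG κ v) hf hwa hσw hw hK'
  have hint := hw.ae_integrableOn_itoDrift hf hσw
  have hae : ∀ᵐ ω ∂preWienerMeasure, ∀ t : ℝ≥0, rsSuperG κ (slePointSlope κ z n t ω) =
      rsSuperG κ (slePointSlope κ z n 0 ω) + timeIntegral (rsSuperGDrift κ z n) t ω + K t ω := by
    filter_upwards [hito] with ω hω t
    have h := hω t
    simp only [deriv_const, zero_add] at h
    rw [h]
    rfl
  refine ⟨K, hK, hKM, ⟨?_, K, hK, ?_⟩, hae⟩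
  · filter_upwards [hint] with ω hω t
    have h := hω t
    simp only [deriv_const, zero_add] at h
    exact h
  · filter_upwards [hae] with ω hω t
    rw [hω t]
    rfl

end Literature.Probability.RandomPlanarGeometry
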